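import Summits.QuantumFields.YangMills.Theorems.FlatTubeReductionOneSiteQuasimodeTrial
import Summits.QuantumFields.YangMills.Theorems.FlatTubeReductionOneSiteQuasimodeCopies
import Summits.QuantumFields.YangMills.Theorems.LuscherReductionOneSiteLevelsAbsLower
import HarnessLib

/-!
# The core estimates for one twist copy of crux ONE's trial state: Rayleigh bound, norm window, second moment
# (rate-twin input of the FLOOR WITH RATE of `stub_boRate`; seat `ym-line-ftr-p1` g9; part 3 of 4 of the concentrated one-site quasimode)

For `φ = 𝟙_+ · ((χ_R f₀) ∘ gnCoord μ)` (`k = 0`, coefficient `1`, cut-off radius `R` with `1 ≤ R ≤ 1/(8μ)`, `e^{−R} ≤ 3072μ³`, `μR ≤ 1/16`), ns `…FemtoTransferGap.Quasimode`: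
* ★ `core_rayleigh` — `linkC(B)³·(1 − 2μE − μ²K)·‖φ‖² ≤ ⟨φ,K_Bφ⟩ + 7·crossBound(B,½)·‖φ‖²`: the trial estimate `trial_estimate_of_cutoff` holds for `Ψ = twistSum φ` (a.e.,
  `twistSum_indicator_upper_ae_eq`), `|⟨Ψ,KΨ⟩ − 8⟨φ,Kφ⟩| ≤ 56·crossBound·‖φ‖²` (`abs_qform_twistSum_sub_le`), `‖φ‖² ≤ μ⁹(2π²)⁻³∫G²`, `linkC³ ≤ e^{6B}Zc`
  (`linkC_pow_three_le_gauss`);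
* ★ `core_norm_moment` — `(13/32)·μ⁹(2π²)⁻³ ≤ ‖φ‖²` (window + `∫G² ≥ ½`) and `∫‖zmCoord 1‖²φ² ≤ 5μ²·(C_f²∫e^{−‖y‖})·‖φ‖²` (chart bound + the decay moments
  `integral_pow_mul_cutSpan_sq_le`): the SECOND-MOMENT CONCENTRATION at the slow scale;
* `latCE_one` (`latCE 1 B = linkC B³`, from the tree's `card_edge_one`).
Sequel: `…OneSiteQuasimode` (thresholds, `e^{−E₁λ_b−Cλ_b²}` form, absorption of the cross-copy terms, support radius `√λ_b`).
HONEST FRAMING: a one-site (finite-dimensional) computation over crux ONE's landed analysis; an input of the RATE twin of RED lane A's C4-CORE for the femto rung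
R2b1 (RECORD label) — route `FlatTubeReduction`, crux K1 `NearFlatRatioLaw` stmt-QuantumFields-24720 / FCL `FixedLatticeLaw` 23943; not infinite volume, not a mass gap,
not Clay.  No new definitions, no named facts, no `sorry`.
-/

set_option autoImplicit false

noncomputable section

open MeasureTheory Filter Topology Real
open scoped Matrix ENNReal BigOperators
open Literature.MathematicalPhysics.QuantumFieldTheory
open Literature.MathematicalPhysics.QuantumLattice
open Literature.Analysis.OperatorTheory.YMMatrixModel

namespace Summit.QuantumFields.YangMills.Theorems.FemtoTransferGap

namespace Quasimode

/-! ## §4 The core estimate for the one-copy restriction of crux ONE's trial state -/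

section Core

variable {f : Fin (0 + 1) → ZM → ℝ}

/-- `latCE 1 B = linkC B³`. [folklore] -/
theorem latCE_one (B : ℝ) : latCE 1 B = linkC B ^ 3 := by
  unfold latCE; rw [card_edge_one]
set_option maxHeartbeats 400000 in
/-- ★ **The core Rayleigh estimate.**  For the one-copy restriction `φ = 𝟙_+ · (G ∘ gnCoord μ)`, `G = χ_R f₀` (`k = 0`, coefficient `1`), under the hypotheses
of `trial_estimate_of_cutoff`, the window condition `μR ≤ 1/16` and `0 ≤ 1 − 2μE − μ²K`:
`linkC³(1 − 2μE − μ²K)·‖φ‖² ≤ ⟨φ,K_Bφ⟩ + 7·crossBound(B,½)·‖φ‖²` (trial estimate on `Ψ = twistSum φ` a.e., minus the seven cross-copy terms).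
[cite: Luscher1983, §2] [cite: ReedSimonIV1978, Thm. XIII.1–2] -/
theorem core_rayleigh (hsmooth : ∀ j, ∀ n : ℕ∞, ContDiff ℝ n (f j)) (hinv : ∀ j, IsGaugeInv (f j))
    {Cf : ℝ} (hCf : ∀ j x, |f j x| ≤ Cf * Real.exp (-‖x‖))
    {A : ℝ} (hA0 : 0 ≤ A)
    (hq : ∀ R : ℝ, 1 ≤ R → ∀ a : Fin (0 + 1) → ℝ,
      energyForm (radialCutoff R * fun x => ∑ j, a j * f j x) ≤
          physLevel (0 + 1) * l2sq (radialCutoff R * fun x => ∑ j, a j * f j x) + A * Real.exp (-R) * ∑ i, ∑ j, |a i| * |a j| ∧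
      ∑ j, a j ^ 2 - A * Real.exp (-R) * ∑ i, ∑ j, |a i| * |a j| ≤ l2sq (radialCutoff R * fun x => ∑ j, a j * f j x))
    {B μ : ℝ} (hB : 0 < B) (hμ : 0 < μ) (hBμ : B * μ ^ 3 = 1 / 4) (hμ8 : μ ≤ 1 / 8) (hεμ : A * ((0:ℕ) + 1) * (3072 * μ ^ 3) ≤ 1 / 2)
    (hBπ : π ≤ B) {R : ℝ} (hR1 : 1 ≤ R) (hRμ : R ≤ 1 / (8 * μ)) (heR : Real.exp (-R) ≤ 3072 * μ ^ 3) (hμR : μ * R ≤ 1 / 16)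
    (ht0 : 0 ≤ 1 - 2 * μ * physLevel (0 + 1) - μ ^ 2 * absLowerK (physLevel (0 + 1)) A (((0:ℕ) + 1) * Cf ^ 2 * ∫ y : ZM, Real.exp (-‖y‖)) 0) :
    linkC B ^ 3 * (1 - 2 * μ * physLevel (0 + 1) - μ ^ 2 * absLowerK (physLevel (0 + 1)) A (((0:ℕ) + 1) * Cf ^ 2 * ∫ y : ZM, Real.exp (-‖y‖)) 0) *
        l2 (Set.indicator {V : Cfg | ∀ e : Edge 3 1, 0 < scalarPart (V e)} (fun U : Cfg => cutSpan f R (fun _ => 1) (gnCoord μ U)))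
           (Set.indicator {V : Cfg | ∀ e : Edge 3 1, 0 < scalarPart (V e)} (fun U : Cfg => cutSpan f R (fun _ => 1) (gnCoord μ U))) ≤
      qform su2Rep B (Set.indicator {V : Cfg | ∀ e : Edge 3 1, 0 < scalarPart (V e)} (fun U : Cfg => cutSpan f R (fun _ => 1) (gnCoord μ U)))
          (Set.indicator {V : Cfg | ∀ e : Edge 3 1, 0 < scalarPart (V e)} (fun U : Cfg => cutSpan f R (fun _ => 1) (gnCoord μ U))) +
        7 * crossBound 1 B (1 / 2) *
          l2 (Set.indicator {V : Cfg | ∀ e : Edge 3 1, 0 < scalarPart (V e)} (fun U : Cfg => cutSpan f R (fun _ => 1) (gnCoord μ U)))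
            (Set.indicator {V : Cfg | ∀ e : Edge 3 1, 0 < scalarPart (V e)} (fun U : Cfg => cutSpan f R (fun _ => 1) (gnCoord μ U))) := by
  have hR0 : 0 < R := lt_of_lt_of_le one_pos hR1
  set a : Fin (0 + 1) → ℝ := fun _ => 1 with hadef
  -- the trial function `G`, its pull-back `Ψ` and the one-copy restriction `φ`
  have hGti := isTestFn_isGaugeInv_radialCutoff_mul_span hR0 hsmooth hinv a
  have hGeq : (radialCutoff R * fun x => ∑ j, a j * f j x) = cutSpan f R a := rfl
  rw [hGeq] at hGti
  obtain ⟨hGtest, hGinv⟩ := hGti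
  have hGm : Measurable (cutSpan f R a) := hGtest.continuous.measurable
  obtain ⟨CG, _, hCG⟩ := GaussForm.exists_bound_of_hasCompactSupport hGtest.continuous hGtest.2
  have hGb : ∃ C : ℝ, ∀ x, |cutSpan f R a x| ≤ C := ⟨CG, hCG⟩
  have hGi : Integrable fun y => cutSpan f R a y ^ 2 := hGtest.integrable_sq
  have hsupp : ∀ y, cutSpan f R a y ≠ 0 → ‖y‖ ≤ Real.sqrt 2 * R := fun y hy => norm_le_of_cutSpan_ne_zero f hR0 a hy
  have hΨ : IsPhys (fun U : Cfg => cutSpan f R a (gnCoord μ U)) := isPhys_gnPullback hGm hGb hGinv μ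
  set φ := Set.indicator {V : Cfg | ∀ e : Edge 3 1, 0 < scalarPart (V e)} (fun U : Cfg => cutSpan f R a (gnCoord μ U)) with hφ
  have hφm : Measurable φ := hΨ.measurable.indicator measurableSet_upper
  have hφb : ∀ U, |φ U| ≤ CG := fun U => by
    rw [hφ, Set.indicator_apply]
    split_ifs
    · exact hCG _
    · rw [abs_zero]; exact (abs_nonneg _).trans (hCG 0)
  -- support of `φ`: all-upper and `‖gnCoord μ U‖ ≤ √2 R`, hence `orbitDist U ≤ 6√3 μ √2 R < 1`
  have hφsupp : ∀ U, φ U ≠ 0 → (∀ e : Edge 3 1, 0 < scalarPart (U e)) ∧ ‖gnCoord μ U‖ ≤ Real.sqrt 2 * R := fun U hU => by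
    rw [hφ] at hU
    by_cases hmem : U ∈ {V : Cfg | ∀ e : Edge 3 1, 0 < scalarPart (V e)}
    · rw [Set.indicator_of_mem hmem] at hU
      exact ⟨hmem, hsupp _ hU⟩
    · exact absurd (Set.indicator_of_notMem hmem _) hU
  have hs2 : Real.sqrt 2 ≤ 3 / 2 := by
    rw [show (3:ℝ) / 2 = Real.sqrt ((3/2) ^ 2) by rw [Real.sqrt_sq (by norm_num)]]
    exact Real.sqrt_le_sqrt (by norm_num)
  have hs3 : Real.sqrt 3 ≤ 2 := by
    rw [show (2:ℝ) = Real.sqrt (2 ^ 2) by rw [Real.sqrt_sq (by norm_num)]]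
    exact Real.sqrt_le_sqrt (by norm_num)
  have hφorb : ∀ U, φ U ≠ 0 → orbitDist U < 5 / 4 := fun U hU => by
    obtain ⟨hup, hn⟩ := hφsupp U hU
    have h := orbitDist_le_of_upper hμ hup hn
    have h6 : Real.sqrt 3 * Real.sqrt 2 ≤ 2 * (3 / 2) := mul_le_mul hs3 hs2 (Real.sqrt_nonneg _) (by norm_num)
    have hμR0 : 0 ≤ μ * R := mul_nonneg hμ.le hR0.le
    have h2 : 6 * Real.sqrt 3 * μ * (Real.sqrt 2 * R) ≤ 6 * (2 * (3 / 2)) * (μ * R) := by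
      rw [show 6 * Real.sqrt 3 * μ * (Real.sqrt 2 * R) = 6 * (Real.sqrt 3 * Real.sqrt 2) * (μ * R) by ring]
      exact mul_le_mul_of_nonneg_right (mul_le_mul_of_nonneg_left h6 (by norm_num)) hμR0
    linarith
  -- (ii) the norm from below and from above
  have hl2 := l2_indicator_upper_gnPullback hμ hGm hGb (G := cutSpan f R a)
  rw [← hφ] at hl2
  have hNlo : (1 : ℝ) / 2 ≤ ∫ y, cutSpan f R a y ^ 2 := by
    obtain ⟨-, h2⟩ := hq R hR1 a
    have hl2sq : l2sq (radialCutoff R * fun x => ∑ j, a j * f j x) = ∫ y, cutSpan f R a y ^ 2 := rfl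
    rw [hl2sq] at h2
    have hsum : ∑ j, a j ^ 2 = 1 := by simp [hadef]
    have hSn : ∑ i, ∑ j, |a i| * |a j| = 1 := by simp [hadef]
    rw [hsum, hSn] at h2
    have : A * Real.exp (-R) * 1 ≤ 1 / 2 := by
      calc A * Real.exp (-R) * 1 ≤ A * (3072 * μ ^ 3) * 1 := by gcongr
        _ = A * ((0:ℕ) + 1) * (3072 * μ ^ 3) := by push_cast; ring
        _ ≤ 1 / 2 := hεμ
    linarith
  have hc0 : 0 < μ ^ 9 * ((2 * π ^ 2)⁻¹) ^ 3 := by positivity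
  have hwin : 1 - 6 * (μ ^ 2 * (Real.sqrt 2 * R) ^ 2) ≥ 13 / 16 := by
    rw [sq_sqrt_two_mul]
    nlinarith [mul_nonneg hμ.le hR0.le]
  have hl2lo : (13 / 32) * (μ ^ 9 * ((2 * π ^ 2)⁻¹) ^ 3) ≤ l2 φ φ := by
    rw [hl2]
    have h : ∫ y, μ ^ 9 * ((2 * π ^ 2)⁻¹) ^ 3 * (13 / 16) * cutSpan f R a y ^ 2 ≤ ∫ y, gnDensityReal μ y * cutSpan f R a y ^ 2 := by
      refine integral_mono (hGi.const_mul _) (integrable_gnDensityReal_mul_sq hμ hGm hGi) fun y => ?_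
      by_cases h0 : cutSpan f R a y = 0
      · simp [h0]
      · have := gnDensityReal_ge_of_norm_le hμ (hsupp y h0)
        exact mul_le_mul_of_nonneg_right (by nlinarith [hc0]) (sq_nonneg _)
    rw [integral_const_mul] at h
    nlinarith [hc0]
  have hl2hi : l2 φ φ ≤ (μ ^ 9 * ((2 * π ^ 2)⁻¹) ^ 3) * ∫ y, cutSpan f R a y ^ 2 := by
    rw [hl2]
    have h : ∫ y, gnDensityReal μ y * cutSpan f R a y ^ 2 ≤ ∫ y, μ ^ 9 * ((2 * π ^ 2)⁻¹) ^ 3 * cutSpan f R a y ^ 2 :=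
      integral_mono_of_nonneg (ae_of_all _ fun y => mul_nonneg (gnDensityReal_pos hμ y).le (sq_nonneg _)) (hGi.const_mul _)
        (ae_of_all _ fun y => mul_le_mul_of_nonneg_right (gnDensityReal_le hμ y) (sq_nonneg _))
    rwa [integral_const_mul] at h
  have hl2nn : 0 ≤ l2 φ φ := l2_self_nonneg_lat _
  -- (i) the Rayleigh bound: trial estimate on `Ψ = twistSum φ` a.e., minus the seven cross-copy terms
  have htrial := trial_estimate_of_cutoff hsmooth hinv hCf hA0 hq hB hμ hBμ hμ8 hεμ hBπ hR1 hRμ heR a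
  have eT : trialMap f R μ a = fun U => cutSpan f R a (gnCoord μ U) := rfl
  rw [eT] at htrial
  have hae := twistSum_indicator_upper_ae_eq hΨ
  rw [← hφ] at hae
  have hqΨ : qform su2Rep B (twistSum φ) (twistSum φ) = qform su2Rep B (fun U => cutSpan f R a (gnCoord μ U)) (fun U => cutSpan f R a (gnCoord μ U)) :=
    qform_congr_ae hae
  have hL : ((1 : ℕ) : ℝ) * (5 / 4 + 1 / 2) < 2 := by norm_num
  have hcross := abs_qform_twistSum_sub_le (L := 1) hB.le hφm hφb (by norm_num : (0:ℝ) ≤ 1 / 2) hL hφorb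
  rw [hqΨ] at hcross
  have hlink : linkC B ^ 3 ≤ Real.exp (6 * B) * (Real.sqrt (π / (B * μ ^ 2)) ^ 9 * (μ ^ 9 * ((2 * π ^ 2)⁻¹) ^ 3)) := by
    have h := linkC_pow_three_le_gauss hB
    have e : Real.sqrt (π / (B * μ ^ 2)) ^ 9 * (μ ^ 9 * ((2 * π ^ 2)⁻¹) ^ 3) = Real.sqrt (π / B) ^ 9 / (2 * π ^ 2) ^ 3 := by
      rw [← mul_assoc, sqrt_div_mul_sq_pow_mul B μ hB hμ]; ring
    rw [e, ← mul_div_assoc]; exact h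
  have hlink0 : 0 ≤ linkC B ^ 3 := pow_nonneg (linkC_pos hB.le).le 3
  -- abbreviate the atoms
  generalize hτ : 1 - 2 * μ * physLevel (0 + 1) - μ ^ 2 * absLowerK (physLevel (0 + 1)) A (((0:ℕ) + 1) * Cf ^ 2 * ∫ y : ZM, Real.exp (-‖y‖)) 0 = τ
    at htrial ht0 ⊢
  generalize hN : ∫ y, cutSpan f R a y ^ 2 = N at htrial hNlo hl2hi
  generalize hc : μ ^ 9 * ((2 * π ^ 2)⁻¹) ^ 3 = c at htrial hlink hc0 hl2hi
  generalize hZ : Real.sqrt (π / (B * μ ^ 2)) ^ 9 = Z at htrial hlink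
  generalize hn : l2 φ φ = n at hcross hl2hi hl2nn ⊢
  generalize hQ : qform su2Rep B φ φ = Q at hcross ⊢
  generalize hQΨ : qform su2Rep B (fun U => cutSpan f R a (gnCoord μ U)) (fun U => cutSpan f R a (gnCoord μ U)) = QΨ at htrial hcross
  have hcB := (crossBound_pos (L := 1) B (1 / 2)).le
  generalize hcBdef : crossBound 1 B (1 / 2) = cB at hcross hcB ⊢
  rw [abs_le] at hcross
  have hZ0 : 0 < Z := by rw [← hZ]; positivity
  -- `8 Q ≥ QΨ − 56 cB n ≥ 8 e^{6B} Z c (c N) τ − 56 cB n ≥ 8 linkC³ τ n − 56 cB n`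
  have hX0 : 0 ≤ Real.exp (6 * B) * (Z * c) := by positivity
  have h1 : 8 * (Real.exp (6 * B) * (Z * c)) * n * τ ≤ 8 * Real.exp (6 * B) * Z * c ^ 2 * N * τ := by
    have h := mul_le_mul_of_nonneg_left hl2hi hX0
    have h' := mul_le_mul_of_nonneg_right h ht0
    nlinarith [h']
  have h2 : 8 * linkC B ^ 3 * n * τ ≤ 8 * (Real.exp (6 * B) * (Z * c)) * n * τ := by
    have := mul_le_mul_of_nonneg_right (mul_le_mul_of_nonneg_right hlink hl2nn) ht0
    linarith
  linarith [hcross.1]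

/-- ★ **Norm and second moment of the one-copy restriction** (same data): `(13/32)·c ≤ ‖φ‖²` (`c = μ⁹(2π²)⁻³`; in particular `‖φ‖² > 0`) and
`∫‖zmCoord 1‖²φ² ≤ 5μ²·(C_f²∫e^{−‖y‖})·‖φ‖²` — the second-moment CONCENTRATION at the slow scale `μ`. [cite: Luscher1983, §2] -/
theorem core_norm_moment (hsmooth : ∀ j, ∀ n : ℕ∞, ContDiff ℝ n (f j)) (hinv : ∀ j, IsGaugeInv (f j))
    {Cf : ℝ} (hCf : ∀ j x, |f j x| ≤ Cf * Real.exp (-‖x‖))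
    {A : ℝ} (hA0 : 0 ≤ A)
    (hq : ∀ R : ℝ, 1 ≤ R → ∀ a : Fin (0 + 1) → ℝ,
      energyForm (radialCutoff R * fun x => ∑ j, a j * f j x) ≤
          physLevel (0 + 1) * l2sq (radialCutoff R * fun x => ∑ j, a j * f j x) + A * Real.exp (-R) * ∑ i, ∑ j, |a i| * |a j| ∧
      ∑ j, a j ^ 2 - A * Real.exp (-R) * ∑ i, ∑ j, |a i| * |a j| ≤ l2sq (radialCutoff R * fun x => ∑ j, a j * f j x))
    {μ : ℝ} (hμ : 0 < μ) (hεμ : A * ((0:ℕ) + 1) * (3072 * μ ^ 3) ≤ 1 / 2)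
    {R : ℝ} (hR1 : 1 ≤ R) (heR : Real.exp (-R) ≤ 3072 * μ ^ 3) (hμR : μ * R ≤ 1 / 16) :
    (13 / 32) * (μ ^ 9 * ((2 * π ^ 2)⁻¹) ^ 3) ≤
      l2 (Set.indicator {V : Cfg | ∀ e : Edge 3 1, 0 < scalarPart (V e)} (fun U : Cfg => cutSpan f R (fun _ => 1) (gnCoord μ U)))
        (Set.indicator {V : Cfg | ∀ e : Edge 3 1, 0 < scalarPart (V e)} (fun U : Cfg => cutSpan f R (fun _ => 1) (gnCoord μ U))) ∧
    ∫ U, ‖zmCoord 1 U‖ ^ 2 * (Set.indicator {V : Cfg | ∀ e : Edge 3 1, 0 < scalarPart (V e)} (fun U : Cfg => cutSpan f R (fun _ => 1) (gnCoord μ U)) U) ^ 2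
        ∂(configMeasure SU2 1) ≤
      5 * μ ^ 2 * (Cf ^ 2 * ∫ y : ZM, Real.exp (-‖y‖)) *
        l2 (Set.indicator {V : Cfg | ∀ e : Edge 3 1, 0 < scalarPart (V e)} (fun U : Cfg => cutSpan f R (fun _ => 1) (gnCoord μ U)))
          (Set.indicator {V : Cfg | ∀ e : Edge 3 1, 0 < scalarPart (V e)} (fun U : Cfg => cutSpan f R (fun _ => 1) (gnCoord μ U))) := by
  have hR0 : 0 < R := lt_of_lt_of_le one_pos hR1
  set a : Fin (0 + 1) → ℝ := fun _ => 1 with hadef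
  -- the trial function `G`, its pull-back `Ψ` and the one-copy restriction `φ`
  have hGti := isTestFn_isGaugeInv_radialCutoff_mul_span hR0 hsmooth hinv a
  have hGeq : (radialCutoff R * fun x => ∑ j, a j * f j x) = cutSpan f R a := rfl
  rw [hGeq] at hGti
  obtain ⟨hGtest, hGinv⟩ := hGti
  have hGm : Measurable (cutSpan f R a) := hGtest.continuous.measurable
  obtain ⟨CG, _, hCG⟩ := GaussForm.exists_bound_of_hasCompactSupport hGtest.continuous hGtest.2
  have hGb : ∃ C : ℝ, ∀ x, |cutSpan f R a x| ≤ C := ⟨CG, hCG⟩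
  have hGi : Integrable fun y => cutSpan f R a y ^ 2 := hGtest.integrable_sq
  have hsupp : ∀ y, cutSpan f R a y ≠ 0 → ‖y‖ ≤ Real.sqrt 2 * R := fun y hy => norm_le_of_cutSpan_ne_zero f hR0 a hy
  have hΨ : IsPhys (fun U : Cfg => cutSpan f R a (gnCoord μ U)) := isPhys_gnPullback hGm hGb hGinv μ
  set φ := Set.indicator {V : Cfg | ∀ e : Edge 3 1, 0 < scalarPart (V e)} (fun U : Cfg => cutSpan f R a (gnCoord μ U)) with hφ
  have hφm : Measurable φ := hΨ.measurable.indicator measurableSet_upper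
  have hφb : ∀ U, |φ U| ≤ CG := fun U => by
    rw [hφ, Set.indicator_apply]
    split_ifs
    · exact hCG _
    · rw [abs_zero]; exact (abs_nonneg _).trans (hCG 0)
  -- support of `φ`: all-upper and `‖gnCoord μ U‖ ≤ √2 R`, hence `orbitDist U ≤ 6√3 μ √2 R < 1`
  have hφsupp : ∀ U, φ U ≠ 0 → (∀ e : Edge 3 1, 0 < scalarPart (U e)) ∧ ‖gnCoord μ U‖ ≤ Real.sqrt 2 * R := fun U hU => by
    rw [hφ] at hU
    by_cases hmem : U ∈ {V : Cfg | ∀ e : Edge 3 1, 0 < scalarPart (V e)}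
    · rw [Set.indicator_of_mem hmem] at hU
      exact ⟨hmem, hsupp _ hU⟩
    · exact absurd (Set.indicator_of_notMem hmem _) hU
  have hs2 : Real.sqrt 2 ≤ 3 / 2 := by
    rw [show (3:ℝ) / 2 = Real.sqrt ((3/2) ^ 2) by rw [Real.sqrt_sq (by norm_num)]]
    exact Real.sqrt_le_sqrt (by norm_num)
  have hs3 : Real.sqrt 3 ≤ 2 := by
    rw [show (2:ℝ) = Real.sqrt (2 ^ 2) by rw [Real.sqrt_sq (by norm_num)]]
    exact Real.sqrt_le_sqrt (by norm_num)
  have hφorb : ∀ U, φ U ≠ 0 → orbitDist U < 5 / 4 := fun U hU => by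
    obtain ⟨hup, hn⟩ := hφsupp U hU
    have h := orbitDist_le_of_upper hμ hup hn
    have h6 : Real.sqrt 3 * Real.sqrt 2 ≤ 2 * (3 / 2) := mul_le_mul hs3 hs2 (Real.sqrt_nonneg _) (by norm_num)
    have hμR0 : 0 ≤ μ * R := mul_nonneg hμ.le hR0.le
    have h2 : 6 * Real.sqrt 3 * μ * (Real.sqrt 2 * R) ≤ 6 * (2 * (3 / 2)) * (μ * R) := by
      rw [show 6 * Real.sqrt 3 * μ * (Real.sqrt 2 * R) = 6 * (Real.sqrt 3 * Real.sqrt 2) * (μ * R) by ring]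
      exact mul_le_mul_of_nonneg_right (mul_le_mul_of_nonneg_left h6 (by norm_num)) hμR0
    linarith
  -- (ii) the norm from below and from above
  have hl2 := l2_indicator_upper_gnPullback hμ hGm hGb (G := cutSpan f R a)
  rw [← hφ] at hl2
  have hNlo : (1 : ℝ) / 2 ≤ ∫ y, cutSpan f R a y ^ 2 := by
    obtain ⟨-, h2⟩ := hq R hR1 a
    have hl2sq : l2sq (radialCutoff R * fun x => ∑ j, a j * f j x) = ∫ y, cutSpan f R a y ^ 2 := rfl
    rw [hl2sq] at h2
    have hsum : ∑ j, a j ^ 2 = 1 := by simp [hadef]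
    have hSn : ∑ i, ∑ j, |a i| * |a j| = 1 := by simp [hadef]
    rw [hsum, hSn] at h2
    have : A * Real.exp (-R) * 1 ≤ 1 / 2 := by
      calc A * Real.exp (-R) * 1 ≤ A * (3072 * μ ^ 3) * 1 := by gcongr
        _ = A * ((0:ℕ) + 1) * (3072 * μ ^ 3) := by push_cast; ring
        _ ≤ 1 / 2 := hεμ
    linarith
  have hc0 : 0 < μ ^ 9 * ((2 * π ^ 2)⁻¹) ^ 3 := by positivity
  have hwin : 1 - 6 * (μ ^ 2 * (Real.sqrt 2 * R) ^ 2) ≥ 13 / 16 := by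
    rw [sq_sqrt_two_mul]
    nlinarith [mul_nonneg hμ.le hR0.le]
  have hl2lo : (13 / 32) * (μ ^ 9 * ((2 * π ^ 2)⁻¹) ^ 3) ≤ l2 φ φ := by
    rw [hl2]
    have h : ∫ y, μ ^ 9 * ((2 * π ^ 2)⁻¹) ^ 3 * (13 / 16) * cutSpan f R a y ^ 2 ≤ ∫ y, gnDensityReal μ y * cutSpan f R a y ^ 2 := by
      refine integral_mono (hGi.const_mul _) (integrable_gnDensityReal_mul_sq hμ hGm hGi) fun y => ?_
      by_cases h0 : cutSpan f R a y = 0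
      · simp [h0]
      · have := gnDensityReal_ge_of_norm_le hμ (hsupp y h0)
        exact mul_le_mul_of_nonneg_right (by nlinarith [hc0]) (sq_nonneg _)
    rw [integral_const_mul] at h
    nlinarith [hc0]
  have hl2hi : l2 φ φ ≤ (μ ^ 9 * ((2 * π ^ 2)⁻¹) ^ 3) * ∫ y, cutSpan f R a y ^ 2 := by
    rw [hl2]
    have h : ∫ y, gnDensityReal μ y * cutSpan f R a y ^ 2 ≤ ∫ y, μ ^ 9 * ((2 * π ^ 2)⁻¹) ^ 3 * cutSpan f R a y ^ 2 :=
      integral_mono_of_nonneg (ae_of_all _ fun y => mul_nonneg (gnDensityReal_pos hμ y).le (sq_nonneg _)) (hGi.const_mul _)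
        (ae_of_all _ fun y => mul_le_mul_of_nonneg_right (gnDensityReal_le hμ y) (sq_nonneg _))
    rwa [integral_const_mul] at h
  have hl2nn : 0 ≤ l2 φ φ := l2_self_nonneg_lat _
  refine ⟨hl2lo, ?_⟩
  -- the second moment
  have hi2 : Integrable fun y => ‖y‖ ^ 2 * cutSpan f R a y ^ 2 :=
    ((continuous_norm.pow 2).mul (hGtest.continuous.pow 2)).integrable_of_hasCompactSupport
      (GaussForm.hasCompactSupport_sq hGtest.2).mul_left
  have hmom := integral_zmCoord_sq_mul_indicator_upper_le hμ hGm hGb hi2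
  rw [← hφ] at hmom
  have hM2 : ∫ y, ‖y‖ ^ 2 * cutSpan f R a y ^ 2 ≤ 2 * (Cf ^ 2 * ∫ y : ZM, Real.exp (-‖y‖)) := by
    have h := integral_pow_mul_cutSpan_sq_le (f := f) hCf R a 2
    have f2 : ((2 : ℕ).factorial : ℝ) = 2 := by norm_num [Nat.factorial]
    have hsum : ∑ j, a j ^ 2 = 1 := by simp [hadef]
    rw [f2, hsum] at h
    calc ∫ y, ‖y‖ ^ 2 * cutSpan f R a y ^ 2 ≤ 2 * ((↑(0:ℕ) + 1) * Cf ^ 2 * ∫ y : ZM, Real.exp (-‖y‖)) * 1 := h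
      _ = 2 * (Cf ^ 2 * ∫ y : ZM, Real.exp (-‖y‖)) := by push_cast; ring
  have hMom0 : 0 ≤ Cf ^ 2 * ∫ y : ZM, Real.exp (-‖y‖) := by
    have : 0 ≤ ∫ y : ZM, Real.exp (-‖y‖) := integral_nonneg fun y => (Real.exp_pos _).le
    positivity
  have hc' : μ ^ 9 * ((2 * π ^ 2)⁻¹) ^ 3 ≤ (32 / 13) * l2 φ φ := by linarith
  have hc2 : (0 : ℝ) ≤ μ ^ 2 * (μ ^ 9 * ((2 * π ^ 2)⁻¹) ^ 3) := by positivity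
  have step1a : μ ^ 2 * (μ ^ 9 * ((2 * π ^ 2)⁻¹) ^ 3) * (∫ y, ‖y‖ ^ 2 * cutSpan f R a y ^ 2) ≤
      μ ^ 2 * (μ ^ 9 * ((2 * π ^ 2)⁻¹) ^ 3) * (2 * (Cf ^ 2 * ∫ y : ZM, Real.exp (-‖y‖))) :=
    mul_le_mul_of_nonneg_left hM2 hc2
  have step1 : ∫ U, ‖zmCoord 1 U‖ ^ 2 * φ U ^ 2 ∂(configMeasure SU2 1) ≤
      μ ^ 2 * (μ ^ 9 * ((2 * π ^ 2)⁻¹) ^ 3) * (2 * (Cf ^ 2 * ∫ y : ZM, Real.exp (-‖y‖))) := le_trans hmom step1a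
  have hM0 : (0 : ℝ) ≤ 2 * (Cf ^ 2 * ∫ y : ZM, Real.exp (-‖y‖)) := by positivity
  have step2a : μ ^ 2 * (μ ^ 9 * ((2 * π ^ 2)⁻¹) ^ 3) ≤ μ ^ 2 * ((32 / 13) * l2 φ φ) := mul_le_mul_of_nonneg_left hc' (sq_nonneg μ)
  have step2 : μ ^ 2 * (μ ^ 9 * ((2 * π ^ 2)⁻¹) ^ 3) * (2 * (Cf ^ 2 * ∫ y : ZM, Real.exp (-‖y‖))) ≤
      μ ^ 2 * ((32 / 13) * l2 φ φ) * (2 * (Cf ^ 2 * ∫ y : ZM, Real.exp (-‖y‖))) := mul_le_mul_of_nonneg_right step2a hM0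
  have hX : 0 ≤ μ ^ 2 * (Cf ^ 2 * ∫ y : ZM, Real.exp (-‖y‖)) * l2 φ φ := by positivity
  have step3 : μ ^ 2 * ((32 / 13) * l2 φ φ) * (2 * (Cf ^ 2 * ∫ y : ZM, Real.exp (-‖y‖))) ≤
      5 * μ ^ 2 * (Cf ^ 2 * ∫ y : ZM, Real.exp (-‖y‖)) * l2 φ φ := by
    have e : μ ^ 2 * ((32 / 13) * l2 φ φ) * (2 * (Cf ^ 2 * ∫ y : ZM, Real.exp (-‖y‖))) =
        (64 / 13) * (μ ^ 2 * (Cf ^ 2 * ∫ y : ZM, Real.exp (-‖y‖)) * l2 φ φ) := by ring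
    rw [e]; linarith
  exact step1.trans (step2.trans step3)

end Core

end Quasimode

end Summit.QuantumFields.YangMills.Theorems.FemtoTransferGap

end
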